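import Literature.NumberTheory.DiophantineGeometry.NamedHypothesesRHProofs
import Literature.NumberTheory.LFunctions.RHClassicalEquivalentsSpeiserProofs
import Literature.NumberTheory.LFunctions.LevinsonMontgomeryTheorem
import Literature.NumberTheory.LFunctions.RiemannHypothesisUpTo101
import Summits.RiemannHypothesis.Statement
import Literature.NumberTheory.LFunctions.ZetaZerosProofs
import HarnessLib

/-!
# Costume detectors VI — the `ζ'` side (Speiser / Levinson–Montgomery height tails), RAW FORMS

rh-split cell, seat (zd, neg) gen 2. ZERO `def`s; proofs over tree theorems only
(`LevinsonMontgomeryTheorem` box constancy / sign theorem / good heights / (1.1),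
`speiser_iff_holds`, certified low-height facts, `riemannHypothesisUpTo_hundredOne`); std axioms.
§1 SPEISER TAIL `∀ s, ζ'(s) = 0 → 0 < Re s < ½ → Im s ≤ H`: `RHUpTo H ∧ tail(H − ½) → RH`
(every `H`; FIN CONSUMED), `RH → tail(H)`, F1-free `tail(H ≤ 100.5) ↔ RH`, F1-conditional at `H₀ − ½`.
§2 FIN IS LOAD-BEARING: `tail(H) → ∃ H', RH above H'` only, `RH above H → tail(H + ½)`, so
`(∃ H, tail) ↔ (∃ H, RH above H)` (class [FOZ]). §3 NEGATIVITY TAIL `Re ζ'/ζ < 0` on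
`[0,½) × (H,∞)` `↔ RH above H` up to a shift `½`; F1-free `↔ RH` for `10.5 ≤ H ≤ 101`. §4 a UNIFORM
LIFTING lemma `RHUpTo T → RHUpTo (T + δ)` (`T ≥ H₀`) is, given F1, RH itself.
HONEST LABEL. SPLITTING SEARCH over kernel-typed RH-EQUIVALENCES; a splitting A ∧ B ⟹ RH is
CONDITIONAL bookkeeping unless A and B are both proved; every tail here is RH-IMPLIED (Speiser
1934 / Levinson–Montgomery 1974): RELABELLING-BY-THEOREM; nothing here bears on the truth of RH.
-/

noncomputable section

set_option linter.dupNamespace false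

open Filter Asymptotics Complex Set
open scoped Real Topology ComplexConjugate

namespace Summit.RiemannHypothesis.RiemannHypothesis.Theorems.Splittings.CostumeDetectorsSpeiser

open Literature.NumberTheory.DiophantineGeometry Literature.NumberTheory.LFunctions

/-! ## §0 Shared helper facts (theorems only) -/

/-- Reflection `s ↦ 1 − conj s` of a zero in the right half-plane. -/
theorem zero_reflect {s : ℂ} (hs : riemannZeta s = 0) (h0 : 0 < s.re) :
    riemannZeta (1 - conj s) = 0 :=
  LevinsonMontgomery.riemannZeta_one_sub_eq_zero (by simpa using h0)
    (by rw [riemannZeta_conj, hs, map_zero])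

/-- zd bookkeeping: RH up to `H` and RH above `H` give RH. [folklore] -/
theorem rh_of_rhUpTo_of_rhAbove {H : ℝ} (hA : RiemannHypothesisUpTo H)
    (hB : (∀ s : ℂ, riemannZeta s = 0 → H < s.im → s.re = 1 / 2)) : _root_.RiemannHypothesis := by
  refine riemannHypothesis_of_forall_riemannHypothesisUpTo_holds fun T s hs h0 _ ↦ ?_
  by_cases hle : s.im ≤ H
  · exact hA s hs h0 hle
  · exact hB s hs (lt_of_not_ge hle)

/-- RH gives RH above every height `H ≥ 0`. [folklore] -/
theorem rhAbove_of_rh (hRH : _root_.RiemannHypothesis) {H : ℝ} (hH : 0 ≤ H) :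
    (∀ s : ℂ, riemannZeta s = 0 → H < s.im → s.re = 1 / 2) :=
  fun s hs hIm ↦ RiemannHypothesisUpTo.of_riemannHypothesis hRH s.im s hs (hH.trans_lt hIm) le_rfl

/-- Under `RiemannHypothesisUpTo H`, every height `t` with `10 ≤ t`, `t + ½ ≤ H` is good. -/
theorem lmGood_of_rhUpTo {H t : ℝ} (hfin : RiemannHypothesisUpTo H) (ht : 10 ≤ t)
    (htH : t + 1 / 2 ≤ H) : lmGood t := by
  intro ρ hρ _ _ hhalf
  by_contra hlt
  have h := abs_lt.1 (not_le.1 hlt)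
  exact hhalf (hfin ρ hρ (by linarith [h.2]) (by linarith [h.1]))

/-- A finite sum of nonnegative integers grows by `≥ 1` when the index set gains a point of weight `≥ 1`. -/
theorem finsum_mem_add_one_le {S S' : Set ℂ} (hS' : S'.Finite) (hsub : S ⊆ S') (f : ℂ → ℤ)
    (hf : ∀ u ∈ S', 0 ≤ f u) {ρ : ℂ} (hρ : ρ ∈ S') (hρS : ρ ∉ S) (hfρ : 1 ≤ f ρ) :
    ∑ᶠ u ∈ S, f u + 1 ≤ ∑ᶠ u ∈ S', f u := by
  have hfinD : (S' \ S).Finite := hS'.subset Set.sdiff_subset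
  have hD : (1 : ℤ) ≤ ∑ᶠ u ∈ S' \ S, f u := by
    rw [finsum_mem_eq_finite_toFinset_sum _ hfinD]
    have hρmem : ρ ∈ hfinD.toFinset := by rw [Set.Finite.mem_toFinset]; exact ⟨hρ, hρS⟩
    calc (1 : ℤ) ≤ f ρ := hfρ
      _ ≤ ∑ u ∈ hfinD.toFinset, f u := by
          apply Finset.single_le_sum (fun u hu ↦ ?_) hρmem
          rw [Set.Finite.mem_toFinset] at hu
          exact hf u hu.1
  rw [← Set.union_sdiff_cancel hsub,
    finsum_mem_union Set.disjoint_sdiff_right (hS'.subset hsub) hfinD]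
  linarith

/-- Strict monotonicity of `N⁻`: a zero of `ζ` in `R_T` with ordinate `≥ t` makes `N⁻(t) < N⁻(T)`. -/
theorem zetaLeftCount_lt_of_mem {t T : ℝ} (htT : t ≤ T) {ρ : ℂ} (hρ : ρ ∈ zetaLeftBox T)
    (ht : t ≤ ρ.im) : zetaLeftCount t < zetaLeftCount T := by
  have hne1 : ∀ u ∈ zetaLeftBox T, u ≠ 1 := by
    rintro u ⟨-, -, h2, -, -⟩ rfl; norm_num at h2
  have key := finsum_mem_add_one_le (S := zetaLeftBox t) (zetaLeftBox_finite T)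
    (fun u ⟨h0, h1, h2, h3, h4⟩ ↦ ⟨h0, h1, h2, h3, lt_of_lt_of_le h4 htT⟩) riemannZetaZeroOrder
    (fun u hu ↦ riemannZetaZeroOrder_nonneg (hne1 u hu)) hρ (fun ⟨_, _, _, _, h4⟩ ↦ by linarith)
    (by have := (riemannZetaZeroOrder_pos_iff (hne1 ρ hρ)).2 hρ.1; omega)
  rw [← zetaLeftCount_int, ← zetaLeftCount_int] at key
  omega

/-! ## §1 The Speiser tail -/

/-- `RH →` the Speiser tail at every height (Speiser's theorem, tree `speiser_iff_holds`):
the tail is RH-IMPLIED. -/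
theorem speiserTail_of_rh (hRH : _root_.RiemannHypothesis) (H : ℝ) :
    (∀ s : ℂ, deriv riemannZeta s = 0 → 0 < s.re → s.re < 1 / 2 → s.im ≤ H) :=
  fun s hs h0 h1 ↦ absurd hs (speiser_iff_holds.1 hRH s h0 h1)

/-- **FIN side**: under `RiemannHypothesisUpTo H`, `ζ'(s) ≠ 0` for `0 < Re s < ½`,
`0 < Im s ≤ H − ½` — certified low heights `≤ 10` (`deriv_riemannZeta_ne_zero_lowHeight`), and the
Levinson–Montgomery sign theorem `Re ζ'/ζ < 0` at the good heights `10 < t ≤ H − ½` (the mechanism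
of the tree's `deriv_riemannZeta_ne_zero_of_abs_im`, at an arbitrary verified height). -/
theorem deriv_ne_zero_of_rhUpTo {H : ℝ} (hfin : RiemannHypothesisUpTo H) {s : ℂ}
    (h0 : 0 < s.re) (h1 : s.re < 1 / 2) (h2 : 0 < s.im) (h3 : s.im ≤ H - 1 / 2) :
    deriv riemannZeta s ≠ 0 := by
  rcases le_or_gt s.im 10 with h10 | h10
  · exact deriv_riemannZeta_ne_zero_lowHeight s h0 h1 h2 h10
  · exact (ne_zero_of_re_logDeriv_neg (re_logDeriv_riemannZeta_neg_of_lmGood'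
      (lmGood_of_rhUpTo hfin h10.le (by linarith)) (by rw [abs_of_pos h2]; exact h10.le)
      h0.le h1)).2

/-- **The gluing in the left strip**: positive heights up to `H − ½` from `RiemannHypothesisUpTo H`,
heights above `H − ½` from the tail, height `0` from `deriv_riemannZeta_ne_zero_of_mem_Ioo_holds`,
negative heights by `ζ'(s̄) = conj ζ'(s)`. -/
theorem speiserLeft_of_rhUpTo_speiserTail {H : ℝ}
    (hfin : RiemannHypothesisUpTo H) (hB : (∀ s : ℂ, deriv riemannZeta s = 0 → 0 < s.re → s.re < 1 / 2 → s.im ≤ H - 1 / 2)) :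
    ∀ s : ℂ, 0 < s.re → s.re < 1 / 2 → deriv riemannZeta s ≠ 0 := by
  have hpos : ∀ s : ℂ, 0 < s.re → s.re < 1 / 2 → 0 < s.im → deriv riemannZeta s ≠ 0 :=
    fun s h0 h1 h2 hs ↦ deriv_ne_zero_of_rhUpTo hfin h0 h1 h2 (hB s hs h0 h1) hs
  intro s h0 h1
  rcases lt_trichotomy s.im 0 with hneg | hzero | hposim
  · intro hs
    have hs' : deriv riemannZeta (conj s) = 0 := by rw [deriv_riemannZeta_conj, hs, map_zero]
    exact hpos (conj s) (by simpa using h0) (by simpa using h1) (by simpa using hneg) hs'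
  · have hsre : s = ((s.re : ℝ) : ℂ) := by
      apply Complex.ext <;> simp [hzero]
    rw [hsre]
    exact deriv_riemannZeta_ne_zero_of_mem_Ioo_holds s.re h0 h1
  · exact hpos s h0 h1 hposim

/-- **Detector (d-Sp1), every height**: `RiemannHypothesisUpTo H ∧ (Speiser tail at H − ½) → RH`;
FIN is CONSUMED (see §2: the tail alone gives only co-finiteness). -/
theorem rh_of_rhUpTo_speiserTail {H : ℝ} (hfin : RiemannHypothesisUpTo H)
    (hB : (∀ s : ℂ, deriv riemannZeta s = 0 → 0 < s.re → s.re < 1 / 2 → s.im ≤ H - 1 / 2)) : _root_.RiemannHypothesis :=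
  speiser_iff_holds.2 (speiserLeft_of_rhUpTo_speiserTail hfin hB)

/-- **F1-free instance**: the Speiser tail at any `H ≤ 100.5` is RH (`riemannHypothesisUpTo_hundredOne`). -/
theorem speiserTail_iff_rh_of_le {H : ℝ} (hH : H ≤ 201 / 2) :
    (∀ s : ℂ, deriv riemannZeta s = 0 → 0 < s.re → s.re < 1 / 2 → s.im ≤ H) ↔ _root_.RiemannHypothesis :=
  ⟨fun hB ↦ rh_of_rhUpTo_speiserTail (H := 101) riemannHypothesisUpTo_hundredOne
      fun s hs h0 h1 ↦ (hB s hs h0 h1).trans (by linarith),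
    fun h ↦ speiserTail_of_rh h H⟩

/-- **CONDITIONAL (F1)**: `riemannHypothesisUpTo_platt_trudgian` (rh.S35, NOT discharged) read as
`F1 → (Speiser tail at H ↔ RH)` for every `H ≤ H₀ − ½`. -/
theorem speiserTail_iff_rh_of_plattTrudgian (hA : riemannHypothesisUpTo_platt_trudgian) {H : ℝ}
    (hH : H ≤ 3000175332800 - 1 / 2) :
    (∀ s : ℂ, deriv riemannZeta s = 0 → 0 < s.re → s.re < 1 / 2 → s.im ≤ H) ↔ _root_.RiemannHypothesis :=
  ⟨fun hB ↦ rh_of_rhUpTo_speiserTail (H := 3000175332800) hA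
      fun s hs h0 h1 ↦ (hB s hs h0 h1).trans hH,
    fun h ↦ speiserTail_of_rh h H⟩

/-! ## §2 FIN is load-bearing: the Speiser tail alone gives only co-finiteness -/

/-- Under the Speiser tail above `H`, the left zero count of `ζ′` is constant in `T ≥ H` (no new left zeros of `ζ′`). [folklore] -/
theorem derivZetaLeftCount_eq_of_speiserTail {H T T' : ℝ} (hB : (∀ s : ℂ, deriv riemannZeta s = 0 → 0 < s.re → s.re < 1 / 2 → s.im ≤ H))
    (hT : H < T) (hT' : H < T') : derivZetaLeftCount T = derivZetaLeftCount T' := by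
  have hbox : derivZetaLeftBox T = derivZetaLeftBox T' := by
    ext ρ
    constructor
    · rintro ⟨h0, h1, h2, h3, -⟩
      exact ⟨h0, h1, h2, h3, lt_of_le_of_lt (hB ρ h0 h1 h2) hT'⟩
    · rintro ⟨h0, h1, h2, h3, -⟩
      exact ⟨h0, h1, h2, h3, lt_of_le_of_lt (hB ρ h0 h1 h2) hT⟩
  unfold derivZetaLeftCount
  rw [hbox]

/-- Under a Speiser tail `N₁⁻` is eventually constant, so by LM (1.1) `N⁻(T) = O(log T)` and the
alternative `N⁻(T) > T/2` eventually of LM (1.2) is excluded. -/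
theorem not_eventually_half_lt_of_speiserTail {H : ℝ} (hB : (∀ s : ℂ, deriv riemannZeta s = 0 → 0 < s.re → s.re < 1 / 2 → s.im ≤ H)) :
    ¬ ∀ᶠ T : ℝ in atTop, T / 2 < (zetaLeftCount T : ℝ) := by
  intro hev
  obtain ⟨C, hC⟩ := levinsonMontgomery_thm1_isBigO_holds.bound
  set K : ℕ := derivZetaLeftCount (H + 1) with hK
  have hconst : ∀ᶠ T : ℝ in atTop, derivZetaLeftCount T = K :=
    (eventually_gt_atTop H).mono fun T hT ↦ derivZetaLeftCount_eq_of_speiserTail hB hT (by linarith)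
  have hlog : ∀ᶠ T : ℝ in atTop, C * ‖Real.log T‖ ≤ T / 4 := by
    have hC' : 0 < |C| + 1 := by positivity
    have := Real.isLittleO_log_id_atTop.def (c := 1 / (4 * (|C| + 1))) (by positivity)
    filter_upwards [this, eventually_ge_atTop (0 : ℝ)] with T hT hT0
    have hlogT : ‖Real.log T‖ ≤ 1 / (4 * (|C| + 1)) * T := by simpa [abs_of_nonneg hT0] using hT
    calc C * ‖Real.log T‖ ≤ (|C| + 1) * ‖Real.log T‖ := by
          gcongr; exact (le_abs_self C).trans (le_add_of_nonneg_right zero_le_one)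
      _ ≤ (|C| + 1) * (1 / (4 * (|C| + 1)) * T) := by gcongr
      _ = T / 4 := by field_simp
  have hK' : ∀ᶠ T : ℝ in atTop, (K : ℝ) ≤ T / 4 :=
    (eventually_ge_atTop (4 * (K : ℝ))).mono fun T hT ↦ by linarith
  obtain ⟨T, h1, h2, h3, h4, h5⟩ := (hev.and (hC.and (hconst.and (hlog.and hK')))).exists
  rw [h3, Real.norm_eq_abs] at h2
  have h6 := (abs_le.1 h2).1
  linarith

/-- **The Speiser tail alone gives only co-finiteness in height** (`∃ H', RH above H'`). -/
theorem exists_rhAbove_of_speiserTail {H : ℝ} (hB : (∀ s : ℂ, deriv riemannZeta s = 0 → 0 < s.re → s.re < 1 / 2 → s.im ≤ H)) :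
    ∃ H' : ℝ, (∀ s : ℂ, riemannZeta s = 0 → H' < s.im → s.re = 1 / 2) := by
  have hnot := not_eventually_half_lt_of_speiserTail hB
  obtain ⟨m₁, hm₁, hgood₁⟩ := frequently_lmGood_nat hnot (⌈max H 11⌉₊ + 1)
  have hmax : max H 11 ≤ (⌈max H 11⌉₊ : ℝ) := Nat.le_ceil _
  have hm₁' : (⌈max H 11⌉₊ : ℝ) + 1 ≤ m₁ := by exact_mod_cast hm₁
  have hm₁H : H < m₁ := by linarith [le_max_left H 11]
  have hm₁11 : (11 : ℝ) ≤ m₁ := by linarith [le_max_right H 11]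
  refine ⟨m₁, fun s hs hIm ↦ ?_⟩
  by_contra hre
  have him : s.im ≠ 0 := by linarith
  have hstrip := re_mem_Ioo_of_riemannZeta_eq_zero_of_im_ne_zero hs him
  -- a zero `ρ` of `ζ` LEFT of the line at the same height
  obtain ⟨ρ, hρ0, hρ1, hρ2, hρim⟩ :
      ∃ ρ : ℂ, riemannZeta ρ = 0 ∧ 0 < ρ.re ∧ ρ.re < 1 / 2 ∧ ρ.im = s.im := by
    rcases lt_or_gt_of_ne hre with hlt | hgt
    · exact ⟨s, hs, hstrip.1, hlt, rfl⟩
    · refine ⟨1 - conj s, zero_reflect hs hstrip.1, ?_, ?_, ?_⟩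
      · simp; linarith [hstrip.2]
      · simp; linarith
      · simp
  -- a good height above `Im s`
  obtain ⟨m₂, hm₂, hgood₂⟩ := frequently_lmGood_nat hnot (⌈s.im⌉₊ + 1)
  have hceil : s.im ≤ (⌈s.im⌉₊ : ℝ) := Nat.le_ceil _
  have hm₂' : (⌈s.im⌉₊ : ℝ) + 1 ≤ m₂ := by exact_mod_cast hm₂
  have hm₂gt : s.im < m₂ := by linarith
  have h12 : (m₁ : ℝ) < m₂ := by linarith
  have h_bot : ∀ x ∈ Ico (0 : ℝ) (1 / 2), (logDeriv riemannZeta (x + (m₁ : ℝ) * I)).re < 0 :=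
    fun x hx ↦ re_logDeriv_riemannZeta_neg_of_lmGood' (by simpa using hgood₁)
      (by simpa using (show (10 : ℕ) ≤ m₁ by exact_mod_cast (show (10 : ℝ) ≤ (m₁ : ℝ) by linarith)))
      (by simpa using hx.1) (by simpa using hx.2)
  have h_top : ∀ x ∈ Ico (0 : ℝ) (1 / 2), (logDeriv riemannZeta (x + (m₂ : ℝ) * I)).re < 0 :=
    fun x hx ↦ re_logDeriv_riemannZeta_neg_of_lmGood' (by simpa using hgood₂)
      (by simpa using (show (10 : ℕ) ≤ m₂ by exact_mod_cast (show (10 : ℝ) ≤ (m₂ : ℝ) by linarith)))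
      (by simpa using hx.1) (by simpa using hx.2)
  have heq := derivZetaLeftCount_sub_eq_of_re_neg (t₁ := (m₁ : ℝ)) (T := (m₂ : ℝ))
    (by linarith) h12 h_bot h_top
  have hN₁ : derivZetaLeftCount (m₂ : ℝ) = derivZetaLeftCount (m₁ : ℝ) :=
    derivZetaLeftCount_eq_of_speiserTail hB (by linarith) hm₁H
  rw [hN₁] at heq
  have hlt := zetaLeftCount_lt_of_mem h12.le
    ⟨hρ0, hρ1, hρ2, by rw [hρim]; linarith, by rw [hρim]; exact hm₂gt⟩ (by rw [hρim]; exact hIm.le)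
  omega

/-- `RH above H` makes every height `t > H + ½` good. -/
theorem lmGood_of_rhAbove {H t : ℝ} (hR : (∀ s : ℂ, riemannZeta s = 0 → H < s.im → s.re = 1 / 2)) (ht : H + 1 / 2 < t) :
    lmGood t := by
  intro ρ hρ _ _ hhalf
  by_contra hlt
  have h := abs_lt.1 (not_le.1 hlt)
  exact hhalf (hR ρ hρ (by linarith [h.2]))

/-- Conversely `RH above H → Speiser tail at H + ½` (`H ≥ 10`), pointwise from the sign theorem. -/
theorem speiserTail_of_rhAbove {H : ℝ} (hH : 10 ≤ H) (hR : (∀ s : ℂ, riemannZeta s = 0 → H < s.im → s.re = 1 / 2)) :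
    (∀ s : ℂ, deriv riemannZeta s = 0 → 0 < s.re → s.re < 1 / 2 → s.im ≤ H + 1 / 2) := by
  intro s hs h0 h1
  by_contra hgt
  have hgt : H + 1 / 2 < s.im := not_le.1 hgt
  exact (ne_zero_of_re_logDeriv_neg (re_logDeriv_riemannZeta_neg_of_lmGood' (lmGood_of_rhAbove hR hgt)
    (by rw [abs_of_pos (by linarith)]; linarith) h0.le h1)).2 hs

/-- **The ∃-tail of the Speiser family is co-finiteness in height** (class [FOZ]), hypothesis-free. -/
theorem exists_speiserTail_iff_exists_rhAbove :
    (∃ H : ℝ, ∀ s : ℂ, deriv riemannZeta s = 0 → 0 < s.re → s.re < 1 / 2 → s.im ≤ H) ↔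
      (∃ H : ℝ, ∀ s : ℂ, riemannZeta s = 0 → H < s.im → s.re = 1 / 2) := by
  refine ⟨fun ⟨H, hB⟩ ↦ exists_rhAbove_of_speiserTail hB, fun ⟨H, hR⟩ ↦ ⟨max H 10 + 1 / 2, ?_⟩⟩
  exact speiserTail_of_rhAbove (le_max_right H 10) fun s hs hIm ↦
    hR s hs (lt_of_le_of_lt (le_max_left H 10) hIm)

/-! ## §3 The negativity / horizontal-monotonicity tail -/

/-- `Re ζ'/ζ < 0` on `[0,½) × (H,∞)` `→ RH above H` (`H ≥ 0`). -/
theorem rhAbove_of_negTail {H : ℝ} (hH : 0 ≤ H) (h : (∀ s : ℂ, 0 ≤ s.re → s.re < 1 / 2 → H < s.im → (logDeriv riemannZeta s).re < 0)) :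
    (∀ s : ℂ, riemannZeta s = 0 → H < s.im → s.re = 1 / 2) := by
  intro s hs hIm
  by_contra hre
  have him : s.im ≠ 0 := (hH.trans_lt hIm).ne'
  have hstrip := re_mem_Ioo_of_riemannZeta_eq_zero_of_im_ne_zero hs him
  rcases lt_or_gt_of_ne hre with hlt | hgt
  · exact (ne_zero_of_re_logDeriv_neg (h s hstrip.1.le hlt hIm)).1 hs
  · have hs' := zero_reflect hs hstrip.1
    refine (ne_zero_of_re_logDeriv_neg (h (1 - conj s) ?_ ?_ ?_)).1 hs'
    · simp; linarith [hstrip.2]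
    · simp; linarith
    · simpa using hIm

/-- `RH above H →` the negativity tail at `H + ½` (`H ≥ 10`; Levinson–Montgomery sign theorem). -/
theorem negTail_of_rhAbove {H : ℝ} (hH : 10 ≤ H) (hR : (∀ s : ℂ, riemannZeta s = 0 → H < s.im → s.re = 1 / 2)) :
    (∀ s : ℂ, 0 ≤ s.re → s.re < 1 / 2 → H + 1 / 2 < s.im → (logDeriv riemannZeta s).re < 0) := by
  intro s h0 h1 hIm
  exact re_logDeriv_riemannZeta_neg_of_lmGood' (lmGood_of_rhAbove hR hIm)
    (by rw [abs_of_nonneg (by linarith)]; linarith) h0 h1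

/-- RH gives the negative-side Speiser tail above every `H ≥ 21/2`. [folklore] -/
theorem negTail_of_rh (hRH : _root_.RiemannHypothesis) {H : ℝ} (hH : 21 / 2 ≤ H) :
    (∀ s : ℂ, 0 ≤ s.re → s.re < 1 / 2 → H < s.im → (logDeriv riemannZeta s).re < 0) := by
  simpa using negTail_of_rhAbove (H := H - 1 / 2) (by linarith) (rhAbove_of_rh hRH (by linarith))

/-- **Detector (d-Sp2), F1-free**: the negativity tail at `10.5 ≤ H ≤ 101` is RH. -/
theorem negTail_iff_rh {H : ℝ} (hH : 21 / 2 ≤ H) (hH' : H ≤ 101) :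
    (∀ s : ℂ, 0 ≤ s.re → s.re < 1 / 2 → H < s.im → (logDeriv riemannZeta s).re < 0) ↔ _root_.RiemannHypothesis := by
  refine ⟨fun hB ↦ ?_, fun h ↦ negTail_of_rh h hH⟩
  refine riemannHypothesis_of_forall_riemannHypothesisUpTo_holds fun T s hs h0 _ ↦ ?_
  by_cases hle : s.im ≤ 101
  · exact riemannHypothesisUpTo_hundredOne s hs h0 hle
  · exact rhAbove_of_negTail (by linarith) hB s hs (by linarith)

/-- **CONDITIONAL (F1)**: the negativity tail at `H₀` is RH, given rh.S35. -/
theorem negTail_iff_rh_of_plattTrudgian (hA : riemannHypothesisUpTo_platt_trudgian) :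
    (∀ s : ℂ, 0 ≤ s.re → s.re < 1 / 2 → (3000175332800 : ℝ) < s.im → (logDeriv riemannZeta s).re < 0) ↔ _root_.RiemannHypothesis :=
  ⟨fun hB ↦ rh_of_rhUpTo_of_rhAbove hA (rhAbove_of_negTail (by norm_num) hB),
    fun h ↦ negTail_of_rh h (by norm_num)⟩

/-! ## §4 A uniform RH-free lifting lemma is RH itself, given FIN -/

/-- **CONDITIONAL (F1)**: a uniform lifting `RHUpTo T → RHUpTo (T + δ)` for all `T ≥ H₀`
(`δ > 0`) is RH-EQUIVALENT given rh.S35 (Archimedean induction): an "induction-on-height" lemma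
with an RH-free step would be RH itself. -/
theorem uniformLift_iff_rh_of_plattTrudgian (hA : riemannHypothesisUpTo_platt_trudgian) {δ : ℝ}
    (hδ : 0 < δ) :
    (∀ T : ℝ, (3000175332800 : ℝ) ≤ T → RiemannHypothesisUpTo T → RiemannHypothesisUpTo (T + δ)) ↔
      _root_.RiemannHypothesis := by
  refine ⟨fun hL ↦ ?_, fun hRH T _ _ ↦ RiemannHypothesisUpTo.of_riemannHypothesis hRH (T + δ)⟩
  have hstep : ∀ n : ℕ, RiemannHypothesisUpTo (3000175332800 + n * δ) := by
    intro n
    induction n with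
    | zero => simpa using (show RiemannHypothesisUpTo 3000175332800 from hA)
    | succ n ih =>
      have := hL (3000175332800 + n * δ) (by simp; positivity) ih
      have heq : (3000175332800 : ℝ) + n * δ + δ = 3000175332800 + (n + 1 : ℕ) * δ := by
        push_cast; ring
      exact heq ▸ this
  refine riemannHypothesis_of_forall_riemannHypothesisUpTo_holds fun T ↦ ?_
  obtain ⟨n, hn⟩ := exists_nat_ge ((T - 3000175332800) / δ)
  refine RiemannHypothesisUpTo.mono_of_le ?_ (hstep n)
  have : (T - 3000175332800) / δ * δ = T - 3000175332800 := div_mul_cancel₀ _ hδ.ne'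
  nlinarith

#print axioms rh_of_rhUpTo_speiserTail
#print axioms speiserTail_iff_rh_of_le
#print axioms speiserTail_iff_rh_of_plattTrudgian
#print axioms exists_rhAbove_of_speiserTail
#print axioms exists_speiserTail_iff_exists_rhAbove
#print axioms negTail_iff_rh
#print axioms negTail_iff_rh_of_plattTrudgian
#print axioms uniformLift_iff_rh_of_plattTrudgian

end Summit.RiemannHypothesis.RiemannHypothesis.Theorems.Splittings.CostumeDetectorsSpeiser

end
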